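import Literature.AlgebraicGeometry.AbelianSchemes.RosatiAtPointOfWeilDivisorPullback
import Literature.AlgebraicGeometry.Motives.AbelianVarietyWeilPairingAdjointOfWeilDivisor
import HarnessLib

/-!
# From the Rosati row `e′ ≫ λ = λ ≫ e^∨` to `D^Θ_{e′P} ∼ e_s^*D^Θ_P` and to `ē^Θ_N(e_s P, Q) = ē^Θ_N(P, e′_s Q)` at a field-valued point
# ([MumfordAV1970] §20 property (3), §23 p. 208; [MumfordFogartyKirwan1994] Def. 6.2–6.3; [MilneAV2008] I §8)

Layer `Literature/AlgebraicGeometry/AbelianSchemes`, namespace `Literature.AlgebraicGeometry.AbelianSchemes.AbelianSchemeOver`.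
THEOREMS ONLY (no definition, no named fact, no instance, no `sorry`).  Cell `hodgecm-mathlib` (D-0151), P6 «MOD programme», crux hLiu418
(`stmt-HodgeConjecture-24832`, `--supports`, count-neutral), line L3 ROOF road «DUAL-B̄» (LA3-plan RULING #3), ISOTROPY organ, step **(ADJ) — the
SCHEME half**: the CONVERSE of ★ `RosatiAtPointOfWeilDivisorPullback` (A-p04, E6-R).  HC_CM is proved only modulo the 2 remaining named inputs
(hLiu418 24832, h413 24833) until rung 0 closes; nothing here is about HC.

THE MATHEMATICS.  `A/S` an abelian scheme with a dual pair `(Â, 𝒫)` (★ `DualPair`), `λ : A → Â` an `S`-morphism which at the field-valued point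
`s : Spec Ω → S` is `Λ(𝒪(Θ))` for a Cartier divisor `Θ` on the fibre `A_s` (★ `IsLambdaOfAt`: the 𝒫-slice at `λ̄(P)` is `t_P^*𝒪(Θ) ⊗ 𝒪(Θ)⁻¹`),
and `e, e′ : A → A` endomorphisms satisfying the ROSATI ROW **`e′ ≫ λ = λ ≫ e^∨`** (`e^∨ = DualPair.dualIsogenyOver e`; for a CM action `ι` with a
`ι`-compatible polarisation this is `ι(ā) ≫ λ = λ ≫ ι(a)^∨`, the `hros` row of the tree's PEL tuples, ★ `RingAction.rosati_row_baseChange`) — or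
merely its base change to `s`.  Then for every `Ω`-point `P` of `A_s`:
(1) the VALUES agree: `λ̄(e′_s P) = λ̄(P) ≫ e^∨` as points `Spec Ω → Â` (composition of `P` with the row);
(2) hence the 𝒫-SLICES agree: `t_{e′P}^*𝒪(Θ) ⊗ 𝒪(Θ)⁻¹ ≅ 𝒫|_{A_s×{λ̄(e′P)}} = 𝒫|_{A_s×{λ̄(P) ≫ e^∨}} ≅ e_s^*(t_P^*𝒪(Θ) ⊗ 𝒪(Θ)⁻¹)`
(★ `IsLambdaOfAt.nonempty_iso`; ★ E6-R §1 `nonempty_pullbackP_valueAt_comp_dualIsogeny_iso` = [MumfordAV1970] §15 Thm. 1: `e^∨` classifies `(e × 1)^*𝒫`);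
(3) hence the WEIL DIVISORS agree: **`D^Θ_{e′_s P} ∼ e_s^*D^Θ_P`** (rank-one modules on the integral `A_s` are isomorphic iff their classes in
`Ȟ¹(A_s, 𝒪^×)` agree, ★ `nonempty_iso_iff_detClass_eq`; the classes are `[𝒪(D^Θ_Q)]`, ★ `detClass_translateTensorDual_eq_cechClass_weilDiv`; `D ↦ [𝒪(D)]`
is injective on classes, ★ `cechClass_eq_iff_linEquiv` — E6-R §2's dictionary read backwards);
(4) hence, by the abelian-variety half ★ `AbelianVariety.weilPairingLevel_map_eq_of_forall_weilDiv_linEquiv` ([MumfordAV1970] §20 (3) in Kummer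
currency), the ADJUNCTION of the level Weil pairing on `A_s[N](Ω)`: **`ē^Θ_N(e_s P, Q) = ē^Θ_N(P, e′_s Q)`** (`e_s` dominant, `[N]` dominant on `A_s`)
— [MumfordAV1970] §23 p. 208 «`e^L(γx, y) = e^L(x, γ′y)`» for the Rosati dual, at a geometric point of ANY characteristic.

* §1 `valueAt_map_fibreHom_eq_valueAt_comp_dualIsogeny_of_pullback_map_eq` (from the base-changed row), `…_of_rosati` (from the global row);
* §2 **`weilDiv_map_linEquiv_pullback_weilDiv_of_pullback_map_eq`**, **`weilDiv_map_linEquiv_pullback_weilDiv_of_rosati`** (the divisor identity);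
* §3 **`weilPairingLevel_map_fibreHom_eq_of_rosati`** (the adjunction, equation binders `P′ = e_s P`, `Q′ = e′_s Q`), `…_of_pullback_map_eq`.

## References
* [MumfordAV1970] D. Mumford, *Abelian Varieties* (1970), §15 Thm. 1 (p. 143), §20 p. 186 property (3), §23 p. 208.
* [MumfordFogartyKirwan1994] D. Mumford, J. Fogarty, F. Kirwan, *Geometric Invariant Theory*, Ch. 6 §2 Def. 6.2–6.3 (p. 120).
* [MilneAV2008] J. S. Milne, *Abelian Varieties* (2008), I §8 pp. 36–37.
* [GortzWedhorn2020] U. Görtz, T. Wedhorn, *Algebraic Geometry I*, Prop. 11.21 (p. 374).  [Hartshorne1977] III Ex. 4.5.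
-/

set_option autoImplicit false

noncomputable section

universe u

open CategoryTheory CategoryTheory.Limits AlgebraicGeometry MonoidalCategory
open scoped MonObj

namespace Literature.AlgebraicGeometry.AbelianSchemes

namespace AbelianSchemeOver

open Literature.AlgebraicGeometry.Motives Literature.AlgebraicGeometry.AbelianVarieties Literature.AlgebraicGeometry.Modules

variable {S : Scheme.{u}} {A : AbelianSchemeOver S} (D : A.DualPair) (lam : A.X ⟶ D.hat.X)
  {Ω : Type u} [Field Ω] (s : Spec (.of Ω) ⟶ S)

/-! ### §1 `λ̄(e′_s P) = λ̄(P) ≫ e^∨` from the Rosati row -/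

/-- **`λ̄(e′_s P) = λ̄(P) ≫ e^∨` as points of `Â`**, from the Rosati row BASE-CHANGED to `s`: `(e′ ≫ λ) ×_S s = (λ ≫ e^∨) ×_S s`.  (The value of an
`S`-morphism `f : A → Y` at the `Ω`-point `P` of `A_s` is the `Y`-component of `P ≫ (f ×_S s)`, ★ `left_comp_pullback_map_comp_fst`; and
`λ̄(e′_s P) = (P ≫ ι_s ≫ e′) ≫ λ`, ★ `fibrePointToLeft_map_fibreHom`.) [cite: MumfordFogartyKirwan1994, Ch. 6 §2 Definition 6.3 (p. 120)]
[cite: MumfordAV1970, §23 (p. 208)] -/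
theorem valueAt_map_fibreHom_eq_valueAt_comp_dualIsogeny_of_pullback_map_eq (e e' : A.X ⟶ A.X) [IsMonHom e] [IsMonHom e']
    (hros : (Over.pullback s).map (e' ≫ lam) = (Over.pullback s).map (lam ≫ DualPair.dualIsogenyOver e D D))
    (P : (A.fibre s).toAbelianVariety.Points Ω) :
    A.valueAt s D lam (AlgPoints.map (fibreHom e' s).hom.hom.hom P) = A.valueAt s D lam P ≫ DualPair.dualIsogeny e D D := by
  have h1 := left_comp_pullback_map_comp_fst (A := A) s (e' ≫ lam) P
  have h2 := left_comp_pullback_map_comp_fst (A := A) s (lam ≫ DualPair.dualIsogenyOver e D D) P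
  rw [hros] at h1
  have h12 := h1.symm.trans h2
  rw [Over.comp_left, Over.comp_left] at h12
  calc A.valueAt s D lam (AlgPoints.map (fibreHom e' s).hom.hom.hom P)
      = A.fibrePointToLeft s (AlgPoints.map (fibreHom e' s).hom.hom.hom P) ≫ lam.left := rfl
    _ = (A.fibrePointToLeft s P ≫ e'.left) ≫ lam.left := by rw [fibrePointToLeft_map_fibreHom]
    _ = A.fibrePointToLeft s P ≫ lam.left ≫ (DualPair.dualIsogenyOver e D D).left := by rw [Category.assoc, h12]
    _ = A.valueAt s D lam P ≫ DualPair.dualIsogeny e D D := by rw [DualPair.dualIsogenyOver_left, ← Category.assoc]; rfl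

/-- **`λ̄(e′_s P) = λ̄(P) ≫ e^∨` as points of `Â`**, from the GLOBAL Rosati row `e′ ≫ λ = λ ≫ e^∨` over `S`.
[cite: MumfordAV1970, §23 (p. 208)] [cite: MumfordFogartyKirwan1994, Ch. 6 §2 Definition 6.3 (p. 120)] -/
theorem valueAt_map_fibreHom_eq_valueAt_comp_dualIsogeny_of_rosati (e e' : A.X ⟶ A.X) [IsMonHom e] [IsMonHom e']
    (hros : e' ≫ lam = lam ≫ DualPair.dualIsogenyOver e D D) (P : (A.fibre s).toAbelianVariety.Points Ω) :
    A.valueAt s D lam (AlgPoints.map (fibreHom e' s).hom.hom.hom P) = A.valueAt s D lam P ≫ DualPair.dualIsogeny e D D :=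
  valueAt_map_fibreHom_eq_valueAt_comp_dualIsogeny_of_pullback_map_eq D lam s e e' (by rw [hros]) P

/-! ### §2 `D^Θ_{e′_s P} ∼ e_s^*D^Θ_P` from the Rosati row -/

/-- **THE WEIL-DIVISOR IDENTITY `D^Θ_{e′_s P} ∼ e_s^*D^Θ_P` FROM THE (base-changed) ROSATI ROW** — the converse of ★
`valueAt_map_fibreHom_eq_valueAt_comp_dualIsogeny` (E6-R §3).  With `λ̄ = Λ(𝒪(Θ))` at `s` and `(e′ ≫ λ) ×_S s = (λ ≫ e^∨) ×_S s`: the 𝒫-slices at the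
equal points `λ̄(e′_s P) = λ̄(P) ≫ e^∨` (§1) are `t_{e′P}^*𝒪(Θ) ⊗ 𝒪(Θ)⁻¹` (★ `IsLambdaOfAt`) and `e_s^*(t_P^*𝒪(Θ) ⊗ 𝒪(Θ)⁻¹)` ([MumfordAV1970] §15 Thm. 1:
`e^∨` classifies `(e × 1)^*𝒫`, ★ `nonempty_pullbackP_valueAt_comp_dualIsogeny_iso`); isomorphic rank-one modules on the integral `A_s` have equal
classes `[𝒪(D^Θ_{e′P})] = e_s^*[𝒪(D^Θ_P)]` in `Ȟ¹(A_s, 𝒪^×)`, i.e. `D^Θ_{e′P} ∼ e_s^*D^Θ_P` (★ `nonempty_iso_iff_detClass_eq`,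
★ `detClass_translateTensorDual_eq_cechClass_weilDiv`, ★ `cechClass_eq_iff_linEquiv`).  `e_s` dominant (so that `e_s^*` of a Cartier divisor makes sense).
[cite: MumfordAV1970, §15 Thm. 1 (p. 143), §20 property (3) (p. 186), §23 (p. 208)] [cite: MumfordFogartyKirwan1994, Ch. 6 §2 Definition 6.2–6.3 (p. 120)]
[cite: GortzWedhorn2020, Prop. 11.21 (p. 374)] -/
theorem weilDiv_map_linEquiv_pullback_weilDiv_of_pullback_map_eq {Θ : CartierDivisor (A.fibre s).toAbelianVariety.X.left}
    (hΘ : A.IsLambdaOfAt s D lam Θ) (e e' : A.X ⟶ A.X) [IsMonHom e] [IsMonHom e']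
    [IsDominant (AbelianVariety.Hom.toSchemeHom (fibreHom e s))]
    (hros : (Over.pullback s).map (e' ≫ lam) = (Over.pullback s).map (lam ≫ DualPair.dualIsogenyOver e D D))
    (P : (A.fibre s).toAbelianVariety.Points Ω) :
    ((A.fibre s).toAbelianVariety.weilDiv Θ (AlgPoints.map (fibreHom e' s).hom.hom.hom P)).LinEquiv
      (((A.fibre s).toAbelianVariety.weilDiv Θ P).pullback (AbelianVariety.Hom.toSchemeHom (fibreHom e s))) := by
  set Q := AlgPoints.map (fibreHom e' s).hom.hom.hom P with hQ
  -- the slice at `λ̄(P) ≫ e^∨` is `e_s^*(t_P^*𝒪(Θ) ⊗ 𝒪(Θ)⁻¹)`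
  obtain ⟨i₁⟩ := nonempty_pullbackP_valueAt_comp_dualIsogeny_iso D lam s hΘ e P
  -- the slice at `λ̄(Q)` is `t_Q^*𝒪(Θ) ⊗ 𝒪(Θ)⁻¹`
  obtain ⟨i₃⟩ := AbelianSchemeOver.IsLambdaOfAt.nonempty_iso A s D lam hΘ Q
  rw [A.sliceAt_obj_eq_pullbackP D s lam Q] at i₃
  -- the two points coincide, hence so do the slices
  have hv := valueAt_map_fibreHom_eq_valueAt_comp_dualIsogeny_of_pullback_map_eq D lam s e e' hros P
  have h₂ : D.pullbackP s (A.valueAt s D lam Q) (A.valueAt_comp_hom s D lam Q) =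
      D.pullbackP s (A.valueAt s D lam P ≫ DualPair.dualIsogeny e D D)
        (by rw [Category.assoc, DualPair.dualIsogeny_comp_hom, valueAt_comp_hom]) :=
    D.pullbackP_congr s hv _ _
  have hiso : Nonempty ((Scheme.Modules.pullback (AbelianVariety.Hom.toSchemeHom (fibreHom e s))).obj
        (tensorObj
          ((Scheme.Modules.pullback ((A.fibre s).toAbelianVariety.translation P).left).obj (A.lineBundleOfDivisor s Θ))
          (Modules.dual (A.lineBundleOfDivisor s Θ))) ≅
      tensorObj
        ((Scheme.Modules.pullback ((A.fibre s).toAbelianVariety.translation Q).left).obj (A.lineBundleOfDivisor s Θ))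
        (Modules.dual (A.lineBundleOfDivisor s Θ))) :=
    ⟨i₁.symm ≪≫ eqToIso h₂.symm ≪≫ i₃⟩
  -- the dictionary: isomorphic slices ⇒ linearly equivalent Weil divisors
  have hP := hasRank_translateTensorDual (A := A) s Θ P
  have hQ' := hasRank_translateTensorDual (A := A) s Θ Q
  have hPf : IsFiniteLocallyFree (tensorObj
      ((Scheme.Modules.pullback ((A.fibre s).toAbelianVariety.translation P).left).obj (A.lineBundleOfDivisor s Θ))
      (Modules.dual (A.lineBundleOfDivisor s Θ))) := HasRank.isFiniteLocallyFree' hP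
  have hQf : IsFiniteLocallyFree (tensorObj
      ((Scheme.Modules.pullback ((A.fibre s).toAbelianVariety.translation Q).left).obj (A.lineBundleOfDivisor s Θ))
      (Modules.dual (A.lineBundleOfDivisor s Θ))) := HasRank.isFiniteLocallyFree' hQ'
  rw [nonempty_iso_iff_detClass_eq (hasRank_pullback _ hP) hQ' (hPf.pullback (AbelianVariety.Hom.toSchemeHom (fibreHom e s))) hQf,
    detClass_pullback (AbelianVariety.Hom.toSchemeHom (fibreHom e s)) hPf,
    detClass_translateTensorDual_eq_cechClass_weilDiv _ Θ P hPf, detClass_translateTensorDual_eq_cechClass_weilDiv _ Θ Q hQf,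
    ← CartierDivisor.cechClass_pullback, CartierDivisor.cechClass_eq_iff_linEquiv] at hiso
  exact hiso.symm

/-- **`D^Θ_{e′_s P} ∼ e_s^*D^Θ_P` for every `Ω`-point `P`, from the GLOBAL Rosati row `e′ ≫ λ = λ ≫ e^∨`** (`λ̄ = Λ(𝒪(Θ))` at `s`, `e_s` dominant).
[cite: MumfordAV1970, §20 property (3) (p. 186) and §23 (p. 208)] [cite: MumfordFogartyKirwan1994, Ch. 6 §2 Definition 6.2–6.3 (p. 120)] -/
theorem weilDiv_map_linEquiv_pullback_weilDiv_of_rosati {Θ : CartierDivisor (A.fibre s).toAbelianVariety.X.left}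
    (hΘ : A.IsLambdaOfAt s D lam Θ) (e e' : A.X ⟶ A.X) [IsMonHom e] [IsMonHom e']
    [IsDominant (AbelianVariety.Hom.toSchemeHom (fibreHom e s))] (hros : e' ≫ lam = lam ≫ DualPair.dualIsogenyOver e D D)
    (P : (A.fibre s).toAbelianVariety.Points Ω) :
    ((A.fibre s).toAbelianVariety.weilDiv Θ (AlgPoints.map (fibreHom e' s).hom.hom.hom P)).LinEquiv
      (((A.fibre s).toAbelianVariety.weilDiv Θ P).pullback (AbelianVariety.Hom.toSchemeHom (fibreHom e s))) :=
  weilDiv_map_linEquiv_pullback_weilDiv_of_pullback_map_eq D lam s hΘ e e' (by rw [hros]) P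

/-! ### §3 The adjunction `ē^Θ_N(e_s P, Q) = ē^Θ_N(P, e′_s Q)` -/

/-- **ROSATI ADJUNCTION OF THE LEVEL WEIL PAIRING AT A FIELD-VALUED POINT, from the base-changed Rosati row.**  For `λ̄ = Λ(𝒪(Θ))` at `s`,
endomorphisms `e, e′` with `(e′ ≫ λ) ×_S s = (λ ≫ e^∨) ×_S s`, `e_s` and `[N]_{A_s}` dominant, and `N`-torsion points `P, Q, P′, Q′` of `A_s` with
`P′ = e_s P`, `Q′ = e′_s Q`: **`ē^Θ_N(P′, Q) = ē^Θ_N(P, Q′)`** (§2 at every point + ★ `AbelianVariety.weilPairingLevel_map_eq_of_forall_weilDiv_linEquiv`).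
[cite: MumfordAV1970, §20 property (3) (p. 186) and §23 (p. 208)] -/
theorem weilPairingLevel_map_fibreHom_eq_of_pullback_map_eq {Θ : CartierDivisor (A.fibre s).toAbelianVariety.X.left}
    (hΘ : A.IsLambdaOfAt s D lam Θ) (e e' : A.X ⟶ A.X) [IsMonHom e] [IsMonHom e']
    [IsDominant (AbelianVariety.Hom.toSchemeHom (fibreHom e s))]
    (hros : (Over.pullback s).map (e' ≫ lam) = (Over.pullback s).map (lam ≫ DualPair.dualIsogenyOver e D D))
    {N : ℕ} [IsDominant (AbelianVariety.Hom.toSchemeHom ((N : ℤ) • 𝟙 (A.fibre s).toAbelianVariety))]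
    (P Q P' Q' : (A.fibre s).toAbelianVariety.torsionPoints Ω N)
    (hP : (P' : (A.fibre s).toAbelianVariety.Points Ω) = AlgPoints.map (fibreHom e s).hom.hom.hom P)
    (hQ : (Q' : (A.fibre s).toAbelianVariety.Points Ω) = AlgPoints.map (fibreHom e' s).hom.hom.hom Q) :
    (A.fibre s).toAbelianVariety.weilPairingLevel Θ P' Q = (A.fibre s).toAbelianVariety.weilPairingLevel Θ P Q' :=
  AbelianVariety.weilPairingLevel_map_eq_of_forall_weilDiv_linEquiv (fibreHom e s) (fibreHom e' s) Θ
    (fun R => weilDiv_map_linEquiv_pullback_weilDiv_of_pullback_map_eq D lam s hΘ e e' hros R) P Q P' Q' hP hQ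

/-- **ROSATI ADJUNCTION OF THE LEVEL WEIL PAIRING AT A FIELD-VALUED POINT** — [MumfordAV1970] §23 «`e^L(γx, y) = e^L(x, γ′y)`» in any characteristic:
for an abelian scheme `A/S` with dual pair `(Â, 𝒫)`, `λ : A → Â` with `λ̄ = Λ(𝒪(Θ))` at `s : Spec Ω → S`, endomorphisms `e, e′` with the Rosati row
`e′ ≫ λ = λ ≫ e^∨` (for a CM action: `e = ι(a)`, `e′ = ι(ā)`), `e_s` and `[N]_{A_s}` dominant, and `N`-torsion points with `P′ = e_s P`, `Q′ = e′_s Q`: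
**`ē^Θ_N(P′, Q) = ē^Θ_N(P, Q′)`**, i.e. `ē^Θ_N(ι(a)P, Q) = ē^Θ_N(P, ι(ā)Q)`. [cite: MumfordAV1970, §20 property (3) (p. 186) and §23 (p. 208)]
[cite: MumfordFogartyKirwan1994, Ch. 6 §2 Definition 6.2–6.3 (p. 120)] -/
theorem weilPairingLevel_map_fibreHom_eq_of_rosati {Θ : CartierDivisor (A.fibre s).toAbelianVariety.X.left}
    (hΘ : A.IsLambdaOfAt s D lam Θ) (e e' : A.X ⟶ A.X) [IsMonHom e] [IsMonHom e']
    [IsDominant (AbelianVariety.Hom.toSchemeHom (fibreHom e s))] (hros : e' ≫ lam = lam ≫ DualPair.dualIsogenyOver e D D)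
    {N : ℕ} [IsDominant (AbelianVariety.Hom.toSchemeHom ((N : ℤ) • 𝟙 (A.fibre s).toAbelianVariety))]
    (P Q P' Q' : (A.fibre s).toAbelianVariety.torsionPoints Ω N)
    (hP : (P' : (A.fibre s).toAbelianVariety.Points Ω) = AlgPoints.map (fibreHom e s).hom.hom.hom P)
    (hQ : (Q' : (A.fibre s).toAbelianVariety.Points Ω) = AlgPoints.map (fibreHom e' s).hom.hom.hom Q) :
    (A.fibre s).toAbelianVariety.weilPairingLevel Θ P' Q = (A.fibre s).toAbelianVariety.weilPairingLevel Θ P Q' :=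
  weilPairingLevel_map_fibreHom_eq_of_pullback_map_eq D lam s hΘ e e' (by rw [hros]) P Q P' Q' hP hQ

end AbelianSchemeOver

end Literature.AlgebraicGeometry.AbelianSchemes

end
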